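import Summits.ValiantsHypothesis.ValiantsHypothesis.Theorems.LacunarySymmetroidMatrixDescartesCensusDoorA34RootType
import Summits.ValiantsHypothesis.ValiantsHypothesis.Theorems.LacunarySymmetroidMatrixDescartesCensusDoorA34FlagLaw
import Mathlib.Analysis.Matrix.PosDef
import Mathlib.LinearAlgebra.CrossProduct

/-!
# `MatrixDescartes` census — DOOR A at `(3,4)`: PLANE COMPRESSIONS of a symmetric pencil ARE the adjugate quadratic forms at the
# plane's normal — the general-plane identity, the DEFINITE-POINT dictionary, and the seven-point law for three letters

HONEST FRAMING.  Object-search cell `pub-symmetroid`, route `LacunarySymmetroid`; beside the OPEN typed statement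
`Theses.LacunarySymmetroid.DoorA34` (stmt-ValiantsHypothesis-19980, `= DoorA34 = PosRootLawAt 3 4 18`), asserted nowhere.
Continuation of `…CensusDoorA34RootRank` / `…RootType` / `…RootWitness` / `…FlagLaw`.  What the tree already holds: at a positive root
`r` of a symmetric `(3,4)` nineteen `adj P(r)` is rank one, semidefinite with the sign `ε(r) = sign tr adj P(r)` (the TYPE); for every
FIXED VECTOR `c` the window polynomial `cᵀ adj P(x) c` lives on the ten pair sums, so it changes sign at most `9` times along positive
points, whence the DEFINITE-WITNESS LAW `witnessed_gaps_le_four` (`…RootWitness`); the `K = 3` support count and the coordinate-plane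
identity `e₃ᵀ adj A e₃ = det A|_{span(e₁,e₂)}` (`…FlagLaw`).  THIS file adds, for ALL supports and with NO definiteness hypothesis on
the letters:

* `det_compress_eq_quadForm_adjugate` — the GENERAL-PLANE IDENTITY: for ANY `3 × 3` matrix `M` over a commutative ring and any
  `3 × 2` matrix `Q` with columns `q₀, q₁`,  `det (Qᵀ M Q) = nᵀ (adj M) n` with `n = q₀ × q₁` (Cauchy–Binet for the second compound):
  the determinant of the compression of `M` to the plane spanned by `q₀, q₁` IS the tree's window polynomial at the plane's normal.  So
  `…RootWitness`'s «witness» reading (`cᵀ adj P(x) c > 0` iff the compression of `P(x)` to `c^⊥` is definite) is an identity, not only a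
  reading for invertible `P(x)`.
* `compress_pencil`, `support_det_compress_pencil_subset`, `card_support_det_compress_pencil_le_ten/_le_six`,
  `signVariations_det_compress_pencil_le_nine/_le_five`, `eval_det_compress_pencil(_eq_quadForm_adjugate)`,
  `sgnChanges_det_compress_le_nine/_le_five` — the same window bookkeeping in COMPRESSION currency (`det (Qᵀ P Q)` is a `2 × 2`
  lacunary pencil determinant on the pair sums: `≤ 10` monomials / `9` variations for `K = 4`, `≤ 6` / `5` for `K = 3`).
* THE DEFINITE-POINT DICTIONARY (new sign facts): `det_compress_pos_of_posDef` / `_of_neg_posDef` — a DEFINITE point `A` (of either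
  sign) gives `det (Qᵀ A Q) > 0` for EVERY injective `Q`; in vector currency `quadForm_adjugate_pos_of_posDef` / `_of_neg_posDef`:
  `cᵀ adj A c > 0` for EVERY `c ≠ 0` — at a definite point every direction is a witness.  Semidefinite points give `≥ 0`
  (`det_compress_nonneg_of_posSemidef` / `_of_neg_posSemidef`); at a singular symmetric point `tr adj A · det (Qᵀ A Q) ≥ 0`
  (`trace_adjugate_mul_det_compress_nonneg`; type `−` ⟹ every compression has `det ≤ 0`, type `+` ⟹ `≥ 0`;
  `type_mul_det_compress_nonneg_of_nineteen` at the roots of a nineteen).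
* PACKAGED LAWS: `no_eleven_alternation_compress` (`K = 4`, the compression form of the definite-witness count) and
  **`no_seven_alternation_compress`** (`K = 3`): a real symmetric THREE-letter pencil that is DEFINITE at `t₀ < t₂ < t₄ < t₆` admits NO
  plane `Q` with `det (Qᵀ G(s) Q) < 0` at interleaved times `s₁ < s₃ < s₅` — «no plane meets three bounded gaps of a definite walk».
  READING (paper, seat report DOOR-A34-P3G13-REPORT.md §2): in an all-semidefinite `(3,3)` nine-row (the source a `(5,2)` flag needs
  for a hierarchical `(3,4)` nineteen, `…FlagLaw`) the walk is `PD | gap | PD | gap | …` with five gaps, `λ₂ > 0` throughout, so a plane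
  through negative vectors of three different bounded gaps would give exactly the forbidden seven-point alternation (interlacing makes the
  compression indefinite, not negative definite): the negative cones of the four bounded gaps admit no common transversal plane through
  any three of them.  This is a located-regime necessary condition, not a bound.

NOTHING here bounds `ζ_sym(3,4)`; `DoorA34` stays OPEN; nothing bears on `MatrixDescartes` (stmt-ValiantsHypothesis-18050) or on
`VP ≠ VNP`.  [folklore] Cauchy–Binet / adjugate algebra of `3 × 3` matrices, positive definiteness of compressions (Mathlib
`Matrix.PosDef.conjTranspose_mul_mul_same`), Descartes' rule along points (tree `sgnChanges_eval_le_signVariations`); no citation needed.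
-/

-- `Summit.ValiantsHypothesis.ValiantsHypothesis.…` repeats a component by the D-0017 layout
-- (single-conjunct summit), which the `dupNamespace` linter flags; the name is mandated.
set_option linter.dupNamespace false

namespace Summit.ValiantsHypothesis.ValiantsHypothesis.Theorems.LacunarySymmetroidMatrixDescartes.Census

open Polynomial Finset
open scoped BigOperators Polynomial Matrix
open Summit.ValiantsHypothesis.ValiantsHypothesis.Theorems.KPlusLogSqLaw.WindowDescartes (sgnChanges
  sgnChanges_eval_le_signVariations)

/-! ## Plane compressions are adjugate quadratic forms at the normal -/

/-- **Cauchy–Binet for the `2 × 2` compound of a `3 × 3` matrix.**  For ANY `3 × 3` matrix `M` over a commutative ring and any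
`3 × 2` matrix `Q` with columns `q₀ = Q·0`, `q₁ = Q·1`: `det (Qᵀ M Q) = nᵀ (adj M) n`, `n = q₀ × q₁` the cross product (the normal of
the plane spanned by the columns). [folklore] -/
theorem det_compress_eq_quadForm_adjugate {R : Type*} [CommRing R] (M : Matrix (Fin 3) (Fin 3) R)
    (Q : Matrix (Fin 3) (Fin 2) R) :
    (Qᵀ * M * Q).det
      = crossProduct (fun i => Q i 0) (fun i => Q i 1) ⬝ᵥ
          (M.adjugate *ᵥ crossProduct (fun i => Q i 0) (fun i => Q i 1)) := by
  rw [Matrix.det_fin_two, Matrix.adjugate_fin_three, cross_apply]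
  simp [Matrix.mul_apply, Matrix.transpose_apply, Fin.sum_univ_three, Matrix.mulVec, dotProduct,
    Matrix.of_apply]
  ring

/-- The same with the normal written out in coordinates. [folklore] -/
theorem det_compress_eq_quadForm_adjugate' {R : Type*} [CommRing R] (M : Matrix (Fin 3) (Fin 3) R)
    (Q : Matrix (Fin 3) (Fin 2) R) :
    (Qᵀ * M * Q).det
      = ![Q 1 0 * Q 2 1 - Q 2 0 * Q 1 1, Q 2 0 * Q 0 1 - Q 0 0 * Q 2 1, Q 0 0 * Q 1 1 - Q 1 0 * Q 0 1] ⬝ᵥ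
          (M.adjugate *ᵥ
            ![Q 1 0 * Q 2 1 - Q 2 0 * Q 1 1, Q 2 0 * Q 0 1 - Q 0 0 * Q 2 1, Q 0 0 * Q 1 1 - Q 1 0 * Q 0 1]) := by
  rw [det_compress_eq_quadForm_adjugate, cross_apply]

/-! ## Plane compressions of a lacunary pencil -/

/-- **Compression commutes with the pencil**: `Qᵀ (Σ_l X^{d l} S_l) Q = Σ_l X^{d l} (Qᵀ S_l Q)` as polynomial matrices
(any sizes, any real letters). [folklore] -/
theorem compress_pencil {K m k : ℕ} (d : Fin K → ℕ) (S : Fin K → Matrix (Fin m) (Fin m) ℝ) (Q : Matrix (Fin m) (Fin k) ℝ) :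
    (Q.map C)ᵀ * (∑ l, ((X : ℝ[X]) ^ d l) • (S l).map C) * Q.map C
      = ∑ l, ((X : ℝ[X]) ^ d l) • ((Qᵀ * S l * Q).map C) := by
  rw [Matrix.mul_sum, Matrix.sum_mul]
  refine Finset.sum_congr rfl fun l _ => ?_
  rw [Matrix.mul_smul, Matrix.smul_mul, Matrix.map_mul, Matrix.map_mul, Matrix.transpose_map]

/-- **The compression determinant lives on the pair sums**: `supp det (Qᵀ P Q) ⊆ {d l + d l'}` for a `3 × 3` lacunary pencil
`P = Σ_l X^{d l} S_l` and any `3 × 2` real `Q`. [folklore] -/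
theorem support_det_compress_pencil_subset {K : ℕ} (d : Fin K → ℕ) (S : Fin K → Matrix (Fin 3) (Fin 3) ℝ)
    (Q : Matrix (Fin 3) (Fin 2) ℝ) :
    ((Q.map C)ᵀ * (∑ l, ((X : ℝ[X]) ^ d l) • (S l).map C) * Q.map C).det.support
      ⊆ (Finset.univ : Finset (Fin 2 → Fin K)).image (fun f => ∑ i, d (f i)) := by
  rw [compress_pencil]
  exact support_det_pencil_subset_sumset d _

/-- `K = 4` letters: a plane compression determinant has at most `10` monomials … [folklore] -/
theorem card_support_det_compress_pencil_le_ten (d : Fin 4 → ℕ) (S : Fin 4 → Matrix (Fin 3) (Fin 3) ℝ)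
    (Q : Matrix (Fin 3) (Fin 2) ℝ) :
    ((Q.map C)ᵀ * (∑ l, ((X : ℝ[X]) ^ d l) • (S l).map C) * Q.map C).det.support.card ≤ 10 :=
  (Finset.card_le_card (support_det_compress_pencil_subset d S Q)).trans (card_pairSums_four_le d)

/-- `K = 3` letters: a plane compression determinant has at most `6` monomials … [folklore] -/
theorem card_support_det_compress_pencil_le_six (d : Fin 3 → ℕ) (S : Fin 3 → Matrix (Fin 3) (Fin 3) ℝ)
    (Q : Matrix (Fin 3) (Fin 2) ℝ) :
    ((Q.map C)ᵀ * (∑ l, ((X : ℝ[X]) ^ d l) • (S l).map C) * Q.map C).det.support.card ≤ 6 :=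
  (Finset.card_le_card (support_det_compress_pencil_subset d S Q)).trans (card_pairSums_three_le d)

/-- … hence at most `9` sign variations (`K = 4`) … [folklore] -/
theorem signVariations_det_compress_pencil_le_nine (d : Fin 4 → ℕ) (S : Fin 4 → Matrix (Fin 3) (Fin 3) ℝ)
    (Q : Matrix (Fin 3) (Fin 2) ℝ) :
    ((Q.map C)ᵀ * (∑ l, ((X : ℝ[X]) ^ d l) • (S l).map C) * Q.map C).det.signVariations ≤ 9 := by
  set g := ((Q.map C)ᵀ * (∑ l, ((X : ℝ[X]) ^ d l) • (S l).map C) * Q.map C).det with hg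
  by_cases h0 : g = 0
  · rw [h0]; simp
  · have h1 := Literature.Computability.AlgebraicComplexity.signVariations_lt_card_support h0
    have h2 := card_support_det_compress_pencil_le_ten d S Q
    rw [← hg] at h2
    omega

/-- … and at most `5` sign variations (`K = 3`). [folklore] -/
theorem signVariations_det_compress_pencil_le_five (d : Fin 3 → ℕ) (S : Fin 3 → Matrix (Fin 3) (Fin 3) ℝ)
    (Q : Matrix (Fin 3) (Fin 2) ℝ) :
    ((Q.map C)ᵀ * (∑ l, ((X : ℝ[X]) ^ d l) • (S l).map C) * Q.map C).det.signVariations ≤ 5 := by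
  set g := ((Q.map C)ᵀ * (∑ l, ((X : ℝ[X]) ^ d l) • (S l).map C) * Q.map C).det with hg
  by_cases h0 : g = 0
  · rw [h0]; simp
  · have h1 := Literature.Computability.AlgebraicComplexity.signVariations_lt_card_support h0
    have h2 := card_support_det_compress_pencil_le_six d S Q
    rw [← hg] at h2
    omega

/-- **Evaluation**: the compression determinant at `x` is `det (Qᵀ P(x) Q)`. [folklore] -/
theorem eval_det_compress_pencil {K : ℕ} (d : Fin K → ℕ) (S : Fin K → Matrix (Fin 3) (Fin 3) ℝ)
    (Q : Matrix (Fin 3) (Fin 2) ℝ) (x : ℝ) :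
    (((Q.map C)ᵀ * (∑ l, ((X : ℝ[X]) ^ d l) • (S l).map C) * Q.map C).det).eval x
      = (Qᵀ * (∑ l, x ^ d l • S l) * Q).det := by
  have h := RingHom.map_det (Polynomial.evalRingHom x)
    ((Q.map C)ᵀ * (∑ l, ((X : ℝ[X]) ^ d l) • (S l).map C) * Q.map C)
  rw [Polynomial.coe_evalRingHom] at h
  rw [h, RingHom.mapMatrix_apply, Matrix.map_mul, Matrix.map_mul, Polynomial.coe_evalRingHom, map_eval_pencil]
  have e1 : (Q.map C).map (eval x) = Q := by
    ext i j
    simp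
  have e2 : ((Q.map C)ᵀ).map (eval x) = Qᵀ := by
    ext i j
    simp
  rw [e1, e2]

/-- The same value as an adjugate quadratic form at the normal `n = q₀ × q₁`. [folklore] -/
theorem eval_det_compress_pencil_eq_quadForm_adjugate {K : ℕ} (d : Fin K → ℕ) (S : Fin K → Matrix (Fin 3) (Fin 3) ℝ)
    (Q : Matrix (Fin 3) (Fin 2) ℝ) (x : ℝ) :
    (((Q.map C)ᵀ * (∑ l, ((X : ℝ[X]) ^ d l) • (S l).map C) * Q.map C).det).eval x
      = crossProduct (fun i => Q i 0) (fun i => Q i 1) ⬝ᵥ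
          ((∑ l, x ^ d l • S l).adjugate *ᵥ crossProduct (fun i => Q i 0) (fun i => Q i 1)) := by
  rw [eval_det_compress_pencil, det_compress_eq_quadForm_adjugate]

/-! ## The sign dictionary at a point -/

/-- A POSITIVE DEFINITE point is seen as `det (Qᵀ A Q) > 0` by every injective `3 × 2` compression. [folklore] -/
theorem det_compress_pos_of_posDef {A : Matrix (Fin 3) (Fin 3) ℝ} (hA : A.PosDef) {Q : Matrix (Fin 3) (Fin 2) ℝ}
    (hQ : Function.Injective Q.mulVec) : 0 < (Qᵀ * A * Q).det := by
  have h := hA.conjTranspose_mul_mul_same hQ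
  rw [Matrix.conjTranspose_eq_transpose_of_trivial] at h
  exact h.det_pos

/-- A NEGATIVE DEFINITE point is ALSO seen as `det (Qᵀ A Q) > 0` (the compression is `2 × 2`). [folklore] -/
theorem det_compress_pos_of_neg_posDef {A : Matrix (Fin 3) (Fin 3) ℝ} (hA : (-A).PosDef) {Q : Matrix (Fin 3) (Fin 2) ℝ}
    (hQ : Function.Injective Q.mulVec) : 0 < (Qᵀ * A * Q).det := by
  have h := det_compress_pos_of_posDef hA hQ
  have hneg : Qᵀ * (-A) * Q = -(Qᵀ * A * Q) := by rw [Matrix.mul_neg, Matrix.neg_mul]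
  rw [hneg, Matrix.det_neg, Fintype.card_fin] at h
  simpa using h

/-- A positive SEMIdefinite point gives `det (Qᵀ A Q) ≥ 0` for every `Q`. [folklore] -/
theorem det_compress_nonneg_of_posSemidef {A : Matrix (Fin 3) (Fin 3) ℝ} (hA : A.PosSemidef)
    (Q : Matrix (Fin 3) (Fin 2) ℝ) : 0 ≤ (Qᵀ * A * Q).det := by
  have h := hA.conjTranspose_mul_mul_same Q
  rw [Matrix.conjTranspose_eq_transpose_of_trivial] at h
  exact h.det_nonneg

/-- A negative semidefinite point gives `det (Qᵀ A Q) ≥ 0` as well. [folklore] -/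
theorem det_compress_nonneg_of_neg_posSemidef {A : Matrix (Fin 3) (Fin 3) ℝ} (hA : (-A).PosSemidef)
    (Q : Matrix (Fin 3) (Fin 2) ℝ) : 0 ≤ (Qᵀ * A * Q).det := by
  have h := det_compress_nonneg_of_posSemidef hA Q
  have hneg : Qᵀ * (-A) * Q = -(Qᵀ * A * Q) := by rw [Matrix.mul_neg, Matrix.neg_mul]
  rw [hneg, Matrix.det_neg, Fintype.card_fin] at h
  simpa using h

/-- **At a definite point every direction is a witness**: `A` positive definite (`3 × 3` real) and `c ≠ 0` give `cᵀ adj A c > 0`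
(with `w = adj A c`: `A w = det A · c`, so `det A · cᵀ adj A c = wᵀ A w > 0`). [folklore] -/
theorem quadForm_adjugate_pos_of_posDef {A : Matrix (Fin 3) (Fin 3) ℝ} (hA : A.PosDef) {c : Fin 3 → ℝ} (hc : c ≠ 0) :
    0 < c ⬝ᵥ (A.adjugate *ᵥ c) := by
  have hdet : 0 < A.det := hA.det_pos
  set w := A.adjugate *ᵥ c with hw
  have hAw : A *ᵥ w = A.det • c := by
    rw [hw, Matrix.mulVec_mulVec, Matrix.mul_adjugate, Matrix.smul_mulVec, Matrix.one_mulVec]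
  have hw0 : w ≠ 0 := by
    intro h0
    have : A.det • c = 0 := by rw [← hAw, h0, Matrix.mulVec_zero]
    rcases smul_eq_zero.mp this with h | h
    · exact absurd h hdet.ne'
    · exact hc h
  have hpos : 0 < star w ⬝ᵥ (A *ᵥ w) := hA.dotProduct_mulVec_pos hw0
  rw [star_trivial, hAw, dotProduct_smul, smul_eq_mul] at hpos
  -- `hpos : 0 < det A * (w ⬝ᵥ c)`; and `w ⬝ᵥ c = c ⬝ᵥ w`
  rw [dotProduct_comm] at hpos
  by_contra hle
  push Not at hle
  have : A.det * (c ⬝ᵥ w) ≤ 0 := mul_nonpos_iff.mpr (Or.inl ⟨hdet.le, hle⟩)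
  linarith

/-- The same at a NEGATIVE definite point (`adj (−A) = adj A` in size three). [folklore] -/
theorem quadForm_adjugate_pos_of_neg_posDef {A : Matrix (Fin 3) (Fin 3) ℝ} (hA : (-A).PosDef) {c : Fin 3 → ℝ} (hc : c ≠ 0) :
    0 < c ⬝ᵥ (A.adjugate *ᵥ c) := by
  have h := quadForm_adjugate_pos_of_posDef hA hc
  rwa [adjugate_neg_fin_three] at h

/-- **At a singular symmetric point the compression determinant has the sign of the TYPE (or vanishes)**:
`tr adj A · det (Qᵀ A Q) ≥ 0` for real symmetric `A` with `det A = 0` and every `3 × 2` real `Q`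
(tree `trace_mul_quadForm_adjugate_nonneg` at the normal vector). [folklore] -/
theorem trace_adjugate_mul_det_compress_nonneg {A : Matrix (Fin 3) (Fin 3) ℝ} (hA : A.IsSymm) (hdet : A.det = 0)
    (Q : Matrix (Fin 3) (Fin 2) ℝ) : 0 ≤ A.adjugate.trace * (Qᵀ * A * Q).det := by
  rw [det_compress_eq_quadForm_adjugate]
  exact trace_mul_quadForm_adjugate_nonneg hA hdet _

/-- **Type `−` (real line pair; the middle-eigenvalue root): EVERY plane compression has `det ≤ 0`.** [folklore] -/
theorem det_compress_nonpos_of_trace_adjugate_neg {A : Matrix (Fin 3) (Fin 3) ℝ} (hA : A.IsSymm) (hdet : A.det = 0)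
    (hneg : A.adjugate.trace < 0) (Q : Matrix (Fin 3) (Fin 2) ℝ) : (Qᵀ * A * Q).det ≤ 0 := by
  have h := trace_adjugate_mul_det_compress_nonneg hA hdet Q
  by_contra hc
  push Not at hc
  have : A.adjugate.trace * (Qᵀ * A * Q).det < 0 := mul_neg_of_neg_of_pos hneg hc
  linarith

/-- Type `+` (conjugate line pair; semidefinite root): every plane compression has `det ≥ 0`. [folklore] -/
theorem det_compress_nonneg_of_trace_adjugate_pos {A : Matrix (Fin 3) (Fin 3) ℝ} (hA : A.IsSymm) (hdet : A.det = 0)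
    (hpos : 0 < A.adjugate.trace) (Q : Matrix (Fin 3) (Fin 2) ℝ) : 0 ≤ (Qᵀ * A * Q).det := by
  have h := trace_adjugate_mul_det_compress_nonneg hA hdet Q
  by_contra hc
  push Not at hc
  have : A.adjugate.trace * (Qᵀ * A * Q).det < 0 := mul_neg_of_pos_of_neg hpos hc
  linarith

/-- **At a root of a symmetric `(3,4)` nineteen**: for every plane `Q`, `ε(r) · det (Qᵀ P(r) Q) ≥ 0` with `ε(r) = tr adj P(r) ≠ 0`
the type of the root (`…RootRank`). [folklore] -/
theorem type_mul_det_compress_nonneg_of_nineteen (d : Fin 4 → ℕ) (S : Fin 4 → Matrix (Fin 3) (Fin 3) ℝ)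
    (hS : ∀ l, (S l).IsSymm)
    (h19 : 19 ≤ ((Matrix.det (∑ l, ((X : ℝ[X]) ^ d l) • (S l).map C)).roots.toFinset.filter (fun t => 0 < t)).card)
    {r : ℝ} (hr0 : 0 < r) (hr : (Matrix.det (∑ l, ((X : ℝ[X]) ^ d l) • (S l).map C)).IsRoot r)
    (Q : Matrix (Fin 3) (Fin 2) ℝ) :
    (∑ l, r ^ d l • S l).adjugate.trace ≠ 0 ∧
      0 ≤ (∑ l, r ^ d l • S l).adjugate.trace * (Qᵀ * (∑ l, r ^ d l • S l) * Q).det := by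
  have hA : (∑ l, r ^ d l • S l).IsSymm := isSymm_pencil_eval d hS r
  have hdet : (∑ l, r ^ d l • S l).det = 0 := by
    have h2 := RingHom.map_det (Polynomial.evalRingHom r) (∑ l, ((X : ℝ[X]) ^ d l) • (S l).map C)
    rw [RingHom.mapMatrix_apply, Polynomial.coe_evalRingHom, map_eval_pencil] at h2
    rw [← h2]
    exact hr.eq_zero
  exact ⟨trace_adjugate_pencil_ne_zero_of_nineteen d S hS h19 hr0 hr, trace_adjugate_mul_det_compress_nonneg hA hdet Q⟩

/-! ## Window counts along points -/

/-- **`K = 4`: a plane compression changes sign at most `9` times along positive points.** [folklore] -/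
theorem sgnChanges_det_compress_le_nine (d : Fin 4 → ℕ) (S : Fin 4 → Matrix (Fin 3) (Fin 3) ℝ)
    (Q : Matrix (Fin 3) (Fin 2) ℝ) (xs : List ℝ) (hsort : xs.Pairwise (· < ·)) (hpos : ∀ x ∈ xs, 0 < x)
    (hne : ∀ x ∈ xs, (Qᵀ * (∑ l, x ^ d l • S l) * Q).det ≠ 0) :
    sgnChanges (xs.map fun x => (Qᵀ * (∑ l, x ^ d l • S l) * Q).det) ≤ 9 := by
  set g := ((Q.map C)ᵀ * (∑ l, ((X : ℝ[X]) ^ d l) • (S l).map C) * Q.map C).det with hg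
  have hmap : (xs.map fun x => (Qᵀ * (∑ l, x ^ d l • S l) * Q).det) = xs.map fun x => g.eval x := by
    refine List.map_congr_left fun x _ => ?_
    rw [hg, eval_det_compress_pencil]
  rw [hmap]
  have hne' : ∀ y ∈ xs, g.eval y ≠ 0 := fun y hy => by
    rw [hg, eval_det_compress_pencil]; exact hne y hy
  exact (sgnChanges_eval_le_signVariations g xs hsort hpos hne').trans (signVariations_det_compress_pencil_le_nine d S Q)

/-- **`K = 3`: a plane compression changes sign at most `5` times along positive points.** [folklore] -/
theorem sgnChanges_det_compress_le_five (d : Fin 3 → ℕ) (S : Fin 3 → Matrix (Fin 3) (Fin 3) ℝ)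
    (Q : Matrix (Fin 3) (Fin 2) ℝ) (xs : List ℝ) (hsort : xs.Pairwise (· < ·)) (hpos : ∀ x ∈ xs, 0 < x)
    (hne : ∀ x ∈ xs, (Qᵀ * (∑ l, x ^ d l • S l) * Q).det ≠ 0) :
    sgnChanges (xs.map fun x => (Qᵀ * (∑ l, x ^ d l • S l) * Q).det) ≤ 5 := by
  set g := ((Q.map C)ᵀ * (∑ l, ((X : ℝ[X]) ^ d l) • (S l).map C) * Q.map C).det with hg
  have hmap : (xs.map fun x => (Qᵀ * (∑ l, x ^ d l • S l) * Q).det) = xs.map fun x => g.eval x := by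
    refine List.map_congr_left fun x _ => ?_
    rw [hg, eval_det_compress_pencil]
  rw [hmap]
  have hne' : ∀ y ∈ xs, g.eval y ≠ 0 := fun y hy => by
    rw [hg, eval_det_compress_pencil]; exact hne y hy
  exact (sgnChanges_eval_le_signVariations g xs hsort hpos hne').trans (signVariations_det_compress_pencil_le_five d S Q)

/-- Eleven alternating non-zero reals have ten sign changes. [folklore] -/
theorem sgnChanges_eleven_alternating (a₀ a₁ a₂ a₃ a₄ a₅ a₆ a₇ a₈ a₉ a₁₀ : ℝ)
    (h₀ : 0 < a₀) (h₁ : a₁ < 0) (h₂ : 0 < a₂) (h₃ : a₃ < 0) (h₄ : 0 < a₄) (h₅ : a₅ < 0) (h₆ : 0 < a₆)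
    (h₇ : a₇ < 0) (h₈ : 0 < a₈) (h₉ : a₉ < 0) (h₁₀ : 0 < a₁₀) :
    sgnChanges [a₀, a₁, a₂, a₃, a₄, a₅, a₆, a₇, a₈, a₉, a₁₀] = 10 := by
  simp only [sgnChanges, KPlusLogSqLaw.WindowDescartes.firstNZ_cons, KPlusLogSqLaw.WindowDescartes.firstNZ_nil,
    h₁.ne, h₂.ne', h₃.ne, h₄.ne', h₅.ne, h₆.ne', h₇.ne, h₈.ne', h₉.ne, h₁₀.ne', if_false]
  have e1 : a₀ * a₁ < 0 := mul_neg_of_pos_of_neg h₀ h₁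
  have e2 : a₁ * a₂ < 0 := mul_neg_of_neg_of_pos h₁ h₂
  have e3 : a₂ * a₃ < 0 := mul_neg_of_pos_of_neg h₂ h₃
  have e4 : a₃ * a₄ < 0 := mul_neg_of_neg_of_pos h₃ h₄
  have e5 : a₄ * a₅ < 0 := mul_neg_of_pos_of_neg h₄ h₅
  have e6 : a₅ * a₆ < 0 := mul_neg_of_neg_of_pos h₅ h₆
  have e7 : a₆ * a₇ < 0 := mul_neg_of_pos_of_neg h₆ h₇
  have e8 : a₇ * a₈ < 0 := mul_neg_of_neg_of_pos h₇ h₈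
  have e9 : a₈ * a₉ < 0 := mul_neg_of_pos_of_neg h₈ h₉
  have e10 : a₉ * a₁₀ < 0 := mul_neg_of_neg_of_pos h₉ h₁₀
  simp [e1, e2, e3, e4, e5, e6, e7, e8, e9, e10]

/-- Seven alternating non-zero reals have six sign changes. [folklore] -/
theorem sgnChanges_seven_alternating (a₀ a₁ a₂ a₃ a₄ a₅ a₆ : ℝ)
    (h₀ : 0 < a₀) (h₁ : a₁ < 0) (h₂ : 0 < a₂) (h₃ : a₃ < 0) (h₄ : 0 < a₄) (h₅ : a₅ < 0) (h₆ : 0 < a₆) :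
    sgnChanges [a₀, a₁, a₂, a₃, a₄, a₅, a₆] = 6 := by
  simp only [sgnChanges, KPlusLogSqLaw.WindowDescartes.firstNZ_cons, KPlusLogSqLaw.WindowDescartes.firstNZ_nil,
    h₁.ne, h₂.ne', h₃.ne, h₄.ne', h₅.ne, h₆.ne', if_false]
  have e1 : a₀ * a₁ < 0 := mul_neg_of_pos_of_neg h₀ h₁
  have e2 : a₁ * a₂ < 0 := mul_neg_of_neg_of_pos h₁ h₂
  have e3 : a₂ * a₃ < 0 := mul_neg_of_pos_of_neg h₂ h₃
  have e4 : a₃ * a₄ < 0 := mul_neg_of_neg_of_pos h₃ h₄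
  have e5 : a₄ * a₅ < 0 := mul_neg_of_pos_of_neg h₄ h₅
  have e6 : a₅ * a₆ < 0 := mul_neg_of_neg_of_pos h₅ h₆
  simp [e1, e2, e3, e4, e5, e6]

/-- **NO ELEVEN-POINT ALTERNATION OF A PLANE COMPRESSION (`K = 4`).**  Along positive points `x₀ < x₁ < ⋯ < x₁₀`, a plane
compression `det (Qᵀ P(x) Q)` of a real `3 × 3` four-letter pencil cannot be `> 0` at the even and `< 0` at the odd positions.
(With the sign dictionary: the plane cannot be definite for `P` at six points interleaved with five type-`−` roots whose kernels
it avoids.) [folklore] -/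
theorem no_eleven_alternation_compress (d : Fin 4 → ℕ) (S : Fin 4 → Matrix (Fin 3) (Fin 3) ℝ)
    (Q : Matrix (Fin 3) (Fin 2) ℝ) (x : Fin 11 → ℝ) (hx : StrictMono x) (hx0 : 0 < x 0)
    (heven : ∀ i : Fin 11, (i : ℕ) % 2 = 0 → 0 < (Qᵀ * (∑ l, x i ^ d l • S l) * Q).det)
    (hodd : ∀ i : Fin 11, (i : ℕ) % 2 = 1 → (Qᵀ * (∑ l, x i ^ d l • S l) * Q).det < 0) : False := by
  set F : ℝ → ℝ := fun y => (Qᵀ * (∑ l, y ^ d l • S l) * Q).det with hF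
  have hpos : ∀ y ∈ (List.ofFn x), 0 < y := by
    intro y hy
    rw [List.mem_ofFn] at hy
    obtain ⟨i, rfl⟩ := hy
    exact lt_of_lt_of_le hx0 (hx.monotone (Fin.zero_le i))
  have hsort : (List.ofFn x).Pairwise (· < ·) := List.pairwise_ofFn.mpr fun i j hij => hx hij
  have hne : ∀ y ∈ (List.ofFn x), F y ≠ 0 := by
    intro y hy
    rw [List.mem_ofFn] at hy
    obtain ⟨i, rfl⟩ := hy
    rcases Nat.mod_two_eq_zero_or_one (i : ℕ) with h | h
    · exact (heven i h).ne'
    · exact (hodd i h).ne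
  have hle := sgnChanges_det_compress_le_nine d S Q (List.ofFn x) hsort hpos hne
  have hlist : (List.ofFn x).map F = [F (x 0), F (x 1), F (x 2), F (x 3), F (x 4), F (x 5), F (x 6), F (x 7), F (x 8),
      F (x 9), F (x 10)] := by
    simp [List.ofFn_succ, Fin.succ]
  have h10 := sgnChanges_eleven_alternating (F (x 0)) (F (x 1)) (F (x 2)) (F (x 3)) (F (x 4)) (F (x 5)) (F (x 6))
    (F (x 7)) (F (x 8)) (F (x 9)) (F (x 10))
    (heven 0 rfl) (hodd 1 rfl) (heven 2 rfl) (hodd 3 rfl) (heven 4 rfl) (hodd 5 rfl) (heven 6 rfl) (hodd 7 rfl)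
    (heven 8 rfl) (hodd 9 rfl) (heven 10 rfl)
  rw [hlist, h10] at hle
  omega

/-- **NO SEVEN-POINT ALTERNATION OF A PLANE COMPRESSION (`K = 3`)** — «no plane meets three bounded gaps»: a real symmetric
three-letter pencil `G` that is DEFINITE at `t₀ < t₂ < t₄ < t₆` cannot have one injective plane compression `Q` with
`det (Qᵀ G(s) Q) < 0` at interleaved times `t₀ < s₁ < t₂ < s₃ < t₄ < s₅ < t₆` (the seven values would alternate: six sign changes of
a six-monomial polynomial). [folklore] -/
theorem no_seven_alternation_compress (d : Fin 3 → ℕ) (S : Fin 3 → Matrix (Fin 3) (Fin 3) ℝ)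
    (Q : Matrix (Fin 3) (Fin 2) ℝ) (hQ : Function.Injective Q.mulVec) (x : Fin 7 → ℝ) (hx : StrictMono x) (hx0 : 0 < x 0)
    (heven : ∀ i : Fin 7, (i : ℕ) % 2 = 0 → (∑ l, x i ^ d l • S l).PosDef ∨ (-(∑ l, x i ^ d l • S l)).PosDef)
    (hodd : ∀ i : Fin 7, (i : ℕ) % 2 = 1 → (Qᵀ * (∑ l, x i ^ d l • S l) * Q).det < 0) : False := by
  set F : ℝ → ℝ := fun y => (Qᵀ * (∑ l, y ^ d l • S l) * Q).det with hF
  have heven' : ∀ i : Fin 7, (i : ℕ) % 2 = 0 → 0 < F (x i) := by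
    intro i hi
    rcases heven i hi with h | h
    · exact det_compress_pos_of_posDef h hQ
    · exact det_compress_pos_of_neg_posDef h hQ
  have hpos : ∀ y ∈ (List.ofFn x), 0 < y := by
    intro y hy
    rw [List.mem_ofFn] at hy
    obtain ⟨i, rfl⟩ := hy
    exact lt_of_lt_of_le hx0 (hx.monotone (Fin.zero_le i))
  have hsort : (List.ofFn x).Pairwise (· < ·) := List.pairwise_ofFn.mpr fun i j hij => hx hij
  have hne : ∀ y ∈ (List.ofFn x), F y ≠ 0 := by
    intro y hy
    rw [List.mem_ofFn] at hy
    obtain ⟨i, rfl⟩ := hy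
    rcases Nat.mod_two_eq_zero_or_one (i : ℕ) with h | h
    · exact (heven' i h).ne'
    · exact (hodd i h).ne
  have hle := sgnChanges_det_compress_le_five d S Q (List.ofFn x) hsort hpos hne
  have hlist : (List.ofFn x).map F = [F (x 0), F (x 1), F (x 2), F (x 3), F (x 4), F (x 5), F (x 6)] := by
    simp [List.ofFn_succ, Fin.succ]
  have h6 := sgnChanges_seven_alternating (F (x 0)) (F (x 1)) (F (x 2)) (F (x 3)) (F (x 4)) (F (x 5)) (F (x 6))
    (heven' 0 rfl) (hodd 1 rfl) (heven' 2 rfl) (hodd 3 rfl) (heven' 4 rfl) (hodd 5 rfl) (heven' 6 rfl)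
  rw [hlist, h6] at hle
  omega

end Summit.ValiantsHypothesis.ValiantsHypothesis.Theorems.LacunarySymmetroidMatrixDescartes.Census
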